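import Literature.Probability.RandomPlanarGeometry.HexSAWRotStripDictionary
import HarnessLib

/-!
# Beaton's rotated strip: monotonicity of `B^{⊥,→}_{H,W}` in the width

Topic `Literature/Probability/RandomPlanarGeometry` (continues `HexSAWRotStripDictionary.lean` — Beaton's rotated strip
domain `HV.rotStripV H W` and its top partition function `HV.rotStripBR H W = B^{⊥,→}_{H,W}(x_c)`).  Source: N. R. Beaton,
J. Phys. A 47 (2014) 075003 (arXiv:1210.0274), §2.2 (the domains `D_{T,L}`, increasing in the width `L`; `B_T(x_c) =
lim_{L→∞} B_{T,L}(x_c)`, §4).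

## Contents (namespace `Literature.Probability.RandomPlanarGeometry.SAW.HV`, all PROVED)

* `rotStripV_mono_width` — `W ≤ W' → D(H, W) ⊆ D(H, W')`;
* **`rotStripBR_mono_width`** — `W ≤ W' → B^{⊥,→}_{H,W} ≤ B^{⊥,→}_{H,W'}` (more room, same top exits; the width
  monotonicity used in the comparison step of the lane's R95, face K95.3).
-/

noncomputable section

open Finset Literature.Probability.LatticeModels Literature.Probability.Percolation

namespace Literature.Probability.RandomPlanarGeometry.SAW

namespace HV

/-- `D(H, W) ⊆ D(H, W')` for `W ≤ W'`. [cite: Beaton2014RotatedHoneycomb, §2.2 (D_{T,L})] -/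
theorem rotStripV_mono_width {H Wd Wd' : ℕ} (h : Wd ≤ Wd') : rotStripV H Wd ⊆ rotStripV H Wd' := by
  intro v hv
  have hW : (Wd : ℤ) ≤ Wd' := by exact_mod_cast h
  simp only [rotStripV, mem_insert, mem_filter, mem_product, mem_Icc, mem_univ, and_true] at hv ⊢
  rcases hv with rfl | rfl | ⟨⟨⟨h1, h2⟩, h3, h4⟩, h5, h6, h7⟩
  · exact Or.inl rfl
  · exact Or.inr (Or.inl rfl)
  · refine Or.inr (Or.inr ⟨⟨⟨by linarith, by linarith⟩, by linarith, by linarith⟩, h5, h6, by linarith⟩)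

/-- **`B^{⊥,→}_{H,W} ≤ B^{⊥,→}_{H,W'}` for `W ≤ W'`**: every right-started walk to the top of `D(H, W) ∖ {a⁻}` is one of
`D(H, W') ∖ {a⁻}`, with the same weight. [cite: Beaton2014RotatedHoneycomb, §2.2 (B_{T,L}); §4 (B_T = lim_L B_{T,L})] -/
theorem rotStripBR_mono_width {H Wd Wd' : ℕ} (h : Wd ≤ Wd') : rotStripBR H Wd ≤ rotStripBR H Wd' := by
  refine sum_le_sum_of_subset_of_nonneg ?_ fun _ _ _ => pow_nonneg hexCriticalFugacity_pos_lt_one.1.le _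
  intro P hP
  rw [mem_filter] at hP ⊢
  exact ⟨midWalks_mono (erase_subset_erase _ (rotStripV_mono_width h)) hP.1, hP.2⟩

end HV

end Literature.Probability.RandomPlanarGeometry.SAW
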